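import Mathlib
import HarnessLib.Audit
import Summits.PneNP.PneNP.Theorems.PstarCrossCaseU2Touch

/-!
# The blind free CROSS gate, regime U2 (node N4): a product row leaves a private tree edge untouched or reads it through a CARRIER (O2 / E1; prover-1 g23)

FRONTIER range-avoidance ladder, rung F-N3 (`stmt-PneNP-19007`), cell `pnp-ideate`; restricted-model proof complexity — nothing here bears on `P` versus `NP`.

Node N4 (`PstarCrossNodes.CrossU2`), continuing `PstarCrossCaseU2Touch`.  `u₀ := u_{e₀} = γ₀ + Q_{D e₀}`; a non-degenerate row `q_{mv} + κ = μ₁ μ₂` or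
`u₀ + (q_{mv} + κ) = μ₁ μ₂` of the constraint `(C, G, T)` behind `q_{mv}`, linear parts `λᵢ(c) = μᵢ(e_c) + μᵢ(0)`.

* `carrier_of_polar` — if `λ₁(b)λ₂(w) + λ₁(w)λ₂(b) = 1` at an AND variable `w` of a private tree edge `π` and a variable `b` off `π`, then some
  private-free monomial of `G` has AND pair `{b, w}` (the polar form of the row at `(e_b, e_w)` is this product — the tree part and the `D e₀` part only
  pair `w` with its mate, `PstarCrossCasePEmptyToggle.andAdj_priv_iff`);
* `corner_false` — the corner of `PstarCrossCaseU2Touch.carrier_or_corner` is impossible when `π ∈ D e₀` and `D e₀` has another edge `j₁`: the product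
  then depends on `x_v, x_{v'}` only, takes the value `1` somewhere (`PstarCrossProductAlgebra.exists_eq_one_one`), and toggling the AND pair of `j₁` moves
  that point into `Z(u₀)`;
* **`touch_or_carrier`** — so when `D e₀ ⊆ {π₁, π₂}` with `π₁` private and `π₂ ∈ D e₀`, a non-degenerate row either leaves `π₁` untouched or `G` has a
  CARRIER: a private-free monomial with one AND variable on `π₁` and the other on `π₂` (the input of `PstarCrossBudgetCarriers.cross_budget_carriers`).
-/

set_option linter.dupNamespace false -- `Summit.PneNP.PneNP.…`: summit = sub-problem name (D-0017 single-conjunct layout)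

open Finset Module Literature.Computability.Complexity
open Summit.PneNP.PneNP.Theorems.PstarTyped (Typed)
open Summit.PneNP.PneNP.Theorems.PstarSALevel (varSet BoundaryExpanding SimpleOverlap)
open Summit.PneNP.PneNP.Theorems.PstarCentreFree (vars_mem_varSet)
open Summit.PneNP.PneNP.Theorems.PstarCubeIdeals (IsAffineFn IsQuadFn)
open Summit.PneNP.PneNP.Theorems.PstarProductRank (qform polar)
open Summit.PneNP.PneNP.Theorems.PstarPathRank (AndAdj polar_basis and_ne)
open Summit.PneNP.PneNP.Theorems.PstarReadSumset (V2)
open Summit.PneNP.PneNP.Theorems.PstarRankRigidityTwo (affine_mul_polar symForm_apply linPart_apply)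
open Summit.PneNP.PneNP.Theorems.PstarChordSystem (ChordSystem)
open Summit.PneNP.PneNP.Theorems.PstarChordBridgeTools
open Summit.PneNP.PneNP.Theorems.PstarChordBridge
open Summit.PneNP.PneNP.Theorems.PstarChordBridgeForcing (freeMon gam sys_u_eq qform_add' rank_four_of_wf)
open Summit.PneNP.PneNP.Theorems.PstarChordBridgeBasis (qDir polarDir)
open Summit.PneNP.PneNP.Theorems.PstarChordBridgeCorner (qDir_add)
open Summit.PneNP.PneNP.Theorems.PstarCrossData (CrossData)
open Summit.PneNP.PneNP.Theorems.PstarCrossSystem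
open Summit.PneNP.PneNP.Theorems.PstarCrossCorner (PrivEdge)
open Summit.PneNP.PneNP.Theorems.PstarCrossCasePEmptyToggle (andAdj_priv_iff)
open Summit.PneNP.PneNP.Theorems.PstarCrossCaseU2 (u_add classification_u)
open Summit.PneNP.PneNP.Theorems.PstarCrossProductRow (untouched_of_product_row)
open Summit.PneNP.PneNP.Theorems.PstarCrossProductAlgebra
open Summit.PneNP.PneNP.Theorems.PstarCrossCaseU2Touch

namespace Summit.PneNP.PneNP.Theorems.PstarCrossCaseU2Carrier

variable {n m : ℕ}

section

variable (I : LocalMap 4 n m) {r : ℕ} {B : BridgeData n m} {e_p e_q g₀ : Fin m}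

/-- **A carrier from the polar form.**  In a row `q_{mv} + κ = μ₁ μ₂` or `u₀ + (q_{mv} + κ) = μ₁ μ₂` of the constraint `(C, G, T)`, if
`λ₁(b)λ₂(w) + λ₁(w)λ₂(b) = 1` for an AND variable `w` of a private tree edge `π` and a variable `b` off `π`, then some private-free monomial of `G` has
AND pair `{b, w}`. -/
theorem carrier_of_polar (hI : I.IsPure xorAndPred) (hS : SimpleOverlap I) (hD : CrossData I r B e_p e_q g₀) {e₀ : Fin m} (he₀ : e₀ ∈ B.N)
    {mv : V2} {G T : Finset (Fin m)} (hTJ : T ⊆ B.J₀ \ B.N)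
    (hpol : ∀ c d : Fin n, polarDir I B mv (Pi.single c 1) (Pi.single d 1) =
      ((polar T (fun j => I.vars j 2) (fun j => I.vars j 3) + polar (freeMon I B.N G) (fun j => I.vars j 2) (fun j => I.vars j 3) :
        LinearMap.BilinForm (ZMod 2) (Fin n → ZMod 2)) (Pi.single c 1)) (Pi.single d 1))
    {κ : ZMod 2} {μ₁ μ₂ : (Fin n → ZMod 2) → ZMod 2} (h₁ : IsAffineFn μ₁) (h₂ : IsAffineFn μ₂)
    (hrow : (∀ x, qDir I B mv x + κ = μ₁ x * μ₂ x) ∨ (∀ x, (sys I B).u e₀ x + (qDir I B mv x + κ) = μ₁ x * μ₂ x))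
    {π : Fin m} (hπ : PrivEdge I B π) {s : Fin 4} (hs : s = 2 ∨ s = 3) {b : Fin n} (hb2 : b ≠ I.vars π 2) (hb3 : b ≠ I.vars π 3)
    (hval : (μ₁ (Pi.single b 1) + μ₁ 0) * (μ₂ (Pi.single (I.vars π s) 1) + μ₂ 0) +
      (μ₁ (Pi.single (I.vars π s) 1) + μ₁ 0) * (μ₂ (Pi.single b 1) + μ₂ 0) = 1) :
    ∃ o ∈ freeMon I B.N G, (I.vars o 2 = b ∧ I.vars o 3 = I.vars π s) ∨ (I.vars o 2 = I.vars π s ∧ I.vars o 3 = b) := by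
  classical
  have hDJ : B.D e₀ ⊆ B.J₀ := (hD.wf.hD e₀ he₀).trans sdiff_subset
  -- the polar form of `q_{mv}`: `ℓ₁ ⊗ ℓ₂ + ℓ₂ ⊗ ℓ₁` (+ the adjacency of `D e₀` in the second row)
  have hpolar : ∀ x y,
      polarDir I B mv x y = (μ₁ x + μ₁ 0) * (μ₂ y + μ₂ 0) + (μ₁ y + μ₁ 0) * (μ₂ x + μ₂ 0) ∨
      polarDir I B mv x y = (μ₁ x + μ₁ 0) * (μ₂ y + μ₂ 0) + (μ₁ y + μ₁ 0) * (μ₂ x + μ₂ 0) +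
        polar (B.D e₀) (fun j => I.vars j 2) (fun j => I.vars j 3) x y := by
    intro x y
    have e := qDir_add I B mv x y
    have hm := affine_mul_polar h₁ h₂ x y
    rw [symForm_apply, linPart_apply, linPart_apply, linPart_apply, linPart_apply] at hm
    rcases hrow with h | h
    · left
      have hx : ∀ z, qDir I B mv z = μ₁ z * μ₂ z + κ := fun z => by
        have e1 : ∀ a k p : ZMod 2, a + k = p → a = p + k := by decide
        exact e1 _ _ _ (h z)
      rw [hx, hx, hx, hx, hm] at e
      have e2 : ∀ a b c s k d : ZMod 2, a + b + c + s + k = a + k + (b + k) + (c + k) + d → d = s := by decide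
      exact e2 _ _ _ _ _ _ e
    · right
      have hx : ∀ z, qDir I B mv z = (sys I B).u e₀ z + μ₁ z * μ₂ z + κ := fun z => by
        have e1 : ∀ u a k p : ZMod 2, u + (a + k) = p → a = u + p + k := by decide
        exact e1 _ _ _ _ (h z)
      rw [hx, hx, hx, hx, hm, u_add I B e₀ x y] at e
      have e2 : ∀ ux uy u0 P a b c s k d : ZMod 2,
          ux + uy + u0 + P + (a + b + c + s) + k = ux + a + k + (uy + b + k) + (u0 + c + k) + d → d = s + P := by decide
      exact e2 _ _ _ _ _ _ _ _ _ _ e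
  -- neither a tree edge of `T` nor an edge of `D e₀` has AND pair `{b, w}`
  have hs' : ∃ s' : Fin 4, (s' = 2 ∨ s' = 3) ∧ s ≠ s' ∧ b ≠ I.vars π s' := by
    rcases hs with rfl | rfl
    · exact ⟨3, Or.inr rfl, by decide, hb3⟩
    · exact ⟨2, Or.inl rfl, by decide, hb2⟩
  obtain ⟨s', hs'23, hss', hbs'⟩ := hs'
  have hT0 : polar (K := ZMod 2) T (fun j => I.vars j 2) (fun j => I.vars j 3) (Pi.single b 1) (Pi.single (I.vars π s) 1) = 0 := by
    rw [polar_basis I hI hS, if_neg]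
    intro hA
    exact hbs' ((andAdj_priv_iff I hI (hTJ.trans sdiff_subset) hπ hs hs'23 hss' b).1 hA).2
  have hD0 : polar (K := ZMod 2) (B.D e₀) (fun j => I.vars j 2) (fun j => I.vars j 3) (Pi.single b 1) (Pi.single (I.vars π s) 1) = 0 := by
    rw [polar_basis I hI hS, if_neg]
    intro hA
    exact hbs' ((andAdj_priv_iff I hI hDJ hπ hs hs'23 hss' b).1 hA).2
  have h1 : polarDir I B mv (Pi.single b 1) (Pi.single (I.vars π s) 1) = 1 := by
    rcases hpolar (Pi.single b 1) (Pi.single (I.vars π s) 1) with h | h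
    · rw [h, hval]
    · rw [h, hval, hD0, add_zero]
  rw [hpol, LinearMap.add_apply, LinearMap.add_apply, hT0, zero_add, polar_basis I hI hS] at h1
  by_cases hA : AndAdj I (freeMon I B.N G) b (I.vars π s)
  · exact hA
  · rw [if_neg hA] at h1
    exact absurd h1 zero_ne_one

/-- **The corner is impossible.**  A non-degenerate product vanishing on `Z(u₀)` whose linear parts are supported on the AND variables `v, v'` of a
private tree edge `π ∈ D e₀` cannot exist when `D e₀` has another edge `j₁`: the product is a non-zero function of `(x_v, x_{v'})`, and toggling the AND
pair of `j₁` moves any point into `Z(u₀)` without changing `(x_v, x_{v'})`. -/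
theorem corner_false (hI : I.IsPure xorAndPred) (hS : SimpleOverlap I) (hD : CrossData I r B e_p e_q g₀)
    {e₀ : Fin m} (he₀ : e₀ ∈ B.N) {μ₁ μ₂ : (Fin n → ZMod 2) → ZMod 2} (h₁ : IsAffineFn μ₁) (h₂ : IsAffineFn μ₂)
    (hn₁ : ∃ z, μ₁ z ≠ μ₁ 0) (hn₂ : ∃ z, μ₂ z ≠ μ₂ 0) (hn : ∃ z, μ₁ z + μ₁ 0 ≠ μ₂ z + μ₂ 0)
    (hZ : ∀ x, (sys I B).u e₀ x = 0 → μ₁ x * μ₂ x = 0) {π : Fin m} (hπ : PrivEdge I B π) {j₁ : Fin m}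
    (hj₁ : j₁ ∈ B.D e₀) (hj₁π : j₁ ≠ π)
    (hoff : ∀ b, b ≠ I.vars π 2 → b ≠ I.vars π 3 → μ₁ (Pi.single b 1) + μ₁ 0 = 0 ∧ μ₂ (Pi.single b 1) + μ₂ 0 = 0) : False := by
  classical
  obtain ⟨y, hy₁, hy₂⟩ := exists_eq_one_one h₁ h₂ hn₁ hn₂ hn 1 1
  have hvv' : I.vars π 2 ≠ I.vars π 3 := and_ne I hI π
  have hab : I.vars j₁ 2 ≠ I.vars j₁ 3 := and_ne I hI j₁
  have hj₁J : j₁ ∈ B.J₀ := (mem_sdiff.1 (hD.wf.hD e₀ he₀ hj₁)).1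
  have hav : I.vars j₁ 2 ≠ I.vars π 2 := ne_of_privEdge I hπ (Or.inl rfl) hj₁J hj₁π 2
  have hav' : I.vars j₁ 2 ≠ I.vars π 3 := ne_of_privEdge I hπ (Or.inr rfl) hj₁J hj₁π 2
  have hbv : I.vars j₁ 3 ≠ I.vars π 2 := ne_of_privEdge I hπ (Or.inl rfl) hj₁J hj₁π 3
  have hbv' : I.vars j₁ 3 ≠ I.vars π 3 := ne_of_privEdge I hπ (Or.inr rfl) hj₁J hj₁π 3
  -- both factors depend only on the coordinates `v, v'`
  have hW : ∀ μ : (Fin n → ZMod 2) → ZMod 2, (∀ c, c ≠ I.vars π 2 → c ≠ I.vars π 3 → μ (Pi.single c 1) + μ 0 = 0) →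
      ∀ i, i ∉ ({I.vars π 2, I.vars π 3} : Finset (Fin n)) → μ (Pi.single i 1) = μ 0 := by
    intro μ h i hi
    rw [mem_insert, mem_singleton, not_or] at hi
    have e : ∀ a b : ZMod 2, a + b = 0 → a = b := by decide
    exact e _ _ (h i hi.1 hi.2)
  have hW₁ := hW μ₁ fun c hc hc' => (hoff c hc hc').1
  have hW₂ := hW μ₂ fun c hc hc' => (hoff c hc hc').2
  -- the projection of `y` to the coordinates `v, v'`, and the toggle of the AND pair of `j₁`
  set pt : Fin n → ZMod 2 := y (I.vars π 2) • Pi.single (I.vars π 2) 1 + y (I.vars π 3) • Pi.single (I.vars π 3) 1 with hpt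
  set tg : Fin n → ZMod 2 := Pi.single (I.vars j₁ 2) 1 + Pi.single (I.vars j₁ 3) 1 with htg
  have hpt_v : pt (I.vars π 2) = y (I.vars π 2) := by
    simp only [hpt, Pi.add_apply, Pi.smul_apply, smul_eq_mul, Pi.single_eq_same, Pi.single_eq_of_ne hvv', mul_one, mul_zero, add_zero]
  have hpt_v' : pt (I.vars π 3) = y (I.vars π 3) := by
    simp only [hpt, Pi.add_apply, Pi.smul_apply, smul_eq_mul, Pi.single_eq_same, Pi.single_eq_of_ne hvv'.symm, mul_one, mul_zero, zero_add]
  have htg_v : tg (I.vars π 2) = 0 := by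
    simp only [htg, Pi.add_apply, Pi.single_eq_of_ne hav.symm, Pi.single_eq_of_ne hbv.symm, add_zero]
  have htg_v' : tg (I.vars π 3) = 0 := by
    simp only [htg, Pi.add_apply, Pi.single_eq_of_ne hav'.symm, Pi.single_eq_of_ne hbv'.symm, add_zero]
  have hagree : ∀ i ∈ ({I.vars π 2, I.vars π 3} : Finset (Fin n)), pt i = y i := by
    intro i hi
    rw [mem_insert, mem_singleton] at hi
    rcases hi with rfl | rfl
    · exact hpt_v
    · exact hpt_v'
  have hagree' : ∀ i ∈ ({I.vars π 2, I.vars π 3} : Finset (Fin n)), (tg + pt) i = y i := by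
    intro i hi
    rw [Pi.add_apply]
    rw [mem_insert, mem_singleton] at hi
    rcases hi with rfl | rfl
    · rw [htg_v, hpt_v, zero_add]
    · rw [htg_v', hpt_v', zero_add]
  have hP_pt : μ₁ pt * μ₂ pt = 1 := by
    rw [affine_eq_of_agree h₁ hW₁ hagree, affine_eq_of_agree h₂ hW₂ hagree, hy₁, hy₂, mul_one]
  have hP_pt' : μ₁ (tg + pt) * μ₂ (tg + pt) = 1 := by
    rw [affine_eq_of_agree h₁ hW₁ hagree', affine_eq_of_agree h₂ hW₂ hagree', hy₁, hy₂, mul_one]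
  -- `u₀ (tg + pt) = u₀ pt + 1`
  have hu_tg : (sys I B).u e₀ tg = gam B e₀ + 1 := by
    rw [sys_u_eq, htg, qform_add', PstarChordBridgeFlat.qform_single I hI, PstarChordBridgeFlat.qform_single I hI,
      PstarChordBridgeFlat.qform_zero, polar_basis I hI hS, if_pos ⟨j₁, hj₁, Or.inl ⟨rfl, rfl⟩⟩, zero_add, zero_add, zero_add]
  have hu_0 : (sys I B).u e₀ 0 = gam B e₀ := by
    rw [sys_u_eq, PstarChordBridgeFlat.qform_zero, add_zero]
  have hDJ : B.D e₀ ⊆ B.J₀ := (hD.wf.hD e₀ he₀).trans sdiff_subset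
  have hA : ∀ (s s' : Fin 4), (s = 2 ∨ s = 3) → (s' = 2 ∨ s' = 3) → s ≠ s' → ∀ t : Fin 4, I.vars j₁ t ≠ I.vars π s' →
      polar (K := ZMod 2) (B.D e₀) (fun j => I.vars j 2) (fun j => I.vars j 3) (Pi.single (I.vars j₁ t) 1) (Pi.single (I.vars π s) 1) = 0 := by
    intro s s' hs hs' hss' t ht
    rw [polar_basis I hI hS, if_neg]
    intro hAdj
    exact ht ((andAdj_priv_iff I hI hDJ hπ hs hs' hss' _).1 hAdj).2
  have hpol0 : polar (B.D e₀) (fun j => I.vars j 2) (fun j => I.vars j 3) tg pt = 0 := by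
    rw [htg, hpt]
    simp only [map_add, map_smul, LinearMap.add_apply, smul_eq_mul]
    rw [hA 2 3 (Or.inl rfl) (Or.inr rfl) (by decide) 2 hav', hA 2 3 (Or.inl rfl) (Or.inr rfl) (by decide) 3 hbv',
      hA 3 2 (Or.inr rfl) (Or.inl rfl) (by decide) 2 hav, hA 3 2 (Or.inr rfl) (Or.inl rfl) (by decide) 3 hbv]
    simp
  have hu_pt' : (sys I B).u e₀ (tg + pt) = (sys I B).u e₀ pt + 1 := by
    rw [u_add I B e₀, hu_tg, hu_0, hpol0]
    generalize (sys I B).u e₀ pt = a; generalize gam B e₀ = c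
    revert a c; decide
  have e01 : ∀ t : ZMod 2, t = 0 ∨ t = 1 := by decide
  rcases e01 ((sys I B).u e₀ pt) with h0 | h1
  · have h := hZ pt h0
    rw [hP_pt] at h
    exact one_ne_zero h
  · have h := hZ (tg + pt) (by rw [hu_pt', h1]; decide)
    rw [hP_pt'] at h
    exact one_ne_zero h

/-- **Touch or carrier.**  If `D e₀ ⊆ {π₁, π₂}` with `π₁` a private tree edge and `π₂ ∈ D e₀` another edge, then a non-degenerate row of the constraint `(C, G, T)` behind
`q_{mv}` either does not read `π₁` at all, or `G` contains a CARRIER: a private-free monomial with one AND variable on `π₁` and the other on `π₂`. -/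
theorem touch_or_carrier (hI : I.IsPure xorAndPred) (hS : SimpleOverlap I) (hB : BoundaryExpanding r I) (hD : CrossData I r B e_p e_q g₀)
    {e₀ : Fin m} (he₀ : e₀ ∈ B.N) {mv : V2} {C : Finset (Fin n)} {G T : Finset (Fin m)} (hTJ : T ⊆ B.J₀ \ B.N) (hGJ : Disjoint G B.J₀)
    (hGfree : ∀ g ∈ G, ¬ (I.vars g 2 ∈ privs I B.N ∨ I.vars g 3 ∈ privs I B.N))
    (hlin : ∀ (π : Fin m) (s : Fin 4), π ∈ B.J₀ \ B.N → 2 ≤ s.val → qDir I B mv (Pi.single (I.vars π s) 1) = qDir I B mv 0 → I.vars π s ∉ C)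
    (hpol : ∀ c d : Fin n, polarDir I B mv (Pi.single c 1) (Pi.single d 1) =
      ((polar T (fun j => I.vars j 2) (fun j => I.vars j 3) + polar (freeMon I B.N G) (fun j => I.vars j 2) (fun j => I.vars j 3) :
        LinearMap.BilinForm (ZMod 2) (Fin n → ZMod 2)) (Pi.single c 1)) (Pi.single d 1))
    {κ : ZMod 2} {μ₁ μ₂ : (Fin n → ZMod 2) → ZMod 2} (h₁ : IsAffineFn μ₁) (h₂ : IsAffineFn μ₂)
    (hn₁ : ∃ z, μ₁ z ≠ μ₁ 0) (hn₂ : ∃ z, μ₂ z ≠ μ₂ 0) (hn : ∃ z, μ₁ z + μ₁ 0 ≠ μ₂ z + μ₂ 0)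
    (hrow : (∀ x, qDir I B mv x + κ = μ₁ x * μ₂ x) ∨ (∀ x, (sys I B).u e₀ x + (qDir I B mv x + κ) = μ₁ x * μ₂ x))
    (hZ : ∀ x, (sys I B).u e₀ x = 0 → μ₁ x * μ₂ x = 0)
    {π₁ π₂ : Fin m} (hπ₁ : PrivEdge I B π₁) (hne : π₁ ≠ π₂) (hπ₂D : π₂ ∈ B.D e₀)
    (hD2 : ∀ j ∈ B.D e₀, j = π₁ ∨ j = π₂) :
    ((I.vars π₁ 2 ∉ C ∧ I.vars π₁ 3 ∉ C) ∧
      ∀ g ∈ G, I.vars g 2 ≠ I.vars π₁ 2 ∧ I.vars g 3 ≠ I.vars π₁ 2 ∧ I.vars g 2 ≠ I.vars π₁ 3 ∧ I.vars g 3 ≠ I.vars π₁ 3) ∨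
    ∃ o ∈ freeMon I B.N G, ∃ s s₂ : Fin 4, (s = 2 ∨ s = 3) ∧ (s₂ = 2 ∨ s₂ = 3) ∧
      ((I.vars o 2 = I.vars π₂ s₂ ∧ I.vars o 3 = I.vars π₁ s) ∨ (I.vars o 2 = I.vars π₁ s ∧ I.vars o 3 = I.vars π₂ s₂)) := by
  classical
  by_cases hoff : ∀ s : Fin 4, (s = 2 ∨ s = 3) → μ₁ (Pi.single (I.vars π₁ s) 1) = μ₁ 0 ∧ μ₂ (Pi.single (I.vars π₁ s) 1) = μ₂ 0
  · exact Or.inl (untouched_of_product_row I hI hS hD he₀ hTJ hGJ hGfree hlin hpol h₁ h₂ hrow hπ₁ hoff)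
  · right
    push Not at hoff
    obtain ⟨s₀, hs₀, hne0⟩ := hoff
    have hv : ¬ (μ₁ (Pi.single (I.vars π₁ s₀) 1) + μ₁ 0 = 0 ∧ μ₂ (Pi.single (I.vars π₁ s₀) 1) + μ₂ 0 = 0) := by
      have e : ∀ a b : ZMod 2, a + b = 0 → a = b := by decide
      exact fun h => hne0 (e _ _ h.1) (e _ _ h.2)
    have hw₀ : I.vars π₁ s₀ = I.vars π₁ 2 ∨ I.vars π₁ s₀ = I.vars π₁ 3 := by
      rcases hs₀ with rfl | rfl
      · exact Or.inl rfl
      · exact Or.inr rfl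
    rcases carrier_or_corner h₁ h₂ hn₁ hn₂ hn (v := I.vars π₁ 2) (v' := I.vars π₁ 3) hw₀ hv with ⟨w, hw, b, hb2, hb3, hval⟩ | hcorner
    · -- `b` is an AND variable of `D e₀`, hence of `π₂`
      have hbD : ∃ j ∈ B.D e₀, I.vars j 2 = b ∨ I.vars j 3 = b := by
        by_contra hno
        push Not at hno
        obtain ⟨hb₁, hb₂⟩ := factors_fixed_off_D I hI hS hB hD he₀ h₁ h₂ hn₁ hn₂ hn hZ (z := b) fun j hj => hno j hj
        rw [hb₁, hb₂, CharTwo.add_self_eq_zero, CharTwo.add_self_eq_zero, zero_mul, mul_zero, add_zero] at hval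
        exact zero_ne_one hval
      obtain ⟨j, hj, hjb⟩ := hbD
      have hjπ₂ : j = π₂ := by
        rcases hD2 j hj with h | h
        · exfalso
          rw [h] at hjb
          rcases hjb with h' | h'
          · exact hb2 h'.symm
          · exact hb3 h'.symm
        · exact h
      rw [hjπ₂] at hjb
      obtain ⟨s, hs, hws⟩ : ∃ s : Fin 4, (s = 2 ∨ s = 3) ∧ w = I.vars π₁ s := by
        rcases hw with h | h
        · exact ⟨2, Or.inl rfl, h⟩
        · exact ⟨3, Or.inr rfl, h⟩
      obtain ⟨s₂, hs₂, hbs₂⟩ : ∃ s₂ : Fin 4, (s₂ = 2 ∨ s₂ = 3) ∧ b = I.vars π₂ s₂ := by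
        rcases hjb with h | h
        · exact ⟨2, Or.inl rfl, h.symm⟩
        · exact ⟨3, Or.inr rfl, h.symm⟩
      subst hws
      obtain ⟨o, ho, hoor⟩ := carrier_of_polar I hI hS hD he₀ hTJ hpol h₁ h₂ hrow hπ₁ hs hb2 hb3 hval
      refine ⟨o, ho, s, s₂, hs, hs₂, ?_⟩
      rw [← hbs₂]
      exact hoor
    · exact (corner_false I hI hS hD he₀ h₁ h₂ hn₁ hn₂ hn hZ hπ₁ hπ₂D hne.symm hcorner).elim

end

end Summit.PneNP.PneNP.Theorems.PstarCrossCaseU2Carrier
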